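import Literature.Barriers.HubbardSuperconductivity.PureModelStripeCompetition
import Literature.MathematicalPhysics.QuantumLattice.HubbardRingPerronFrobeniusProofs
import HarnessLib

/-!
# `PureModelStripeCompetition` is a contentful (non-vacuous) claim — proofs

Companion to `Literature/Barriers/HubbardSuperconductivity/PureModelStripeCompetition.lean` (barrier
catalogue, D-0021). That entry transcribes a NUMERICAL finding — Qin et al., PRX 10 (2020) 031016
(`QinEtAl2020`), §III.B, Fig. 9: at `U = 8`, `h = 1/8` the width- and pairing-field-extrapolated
`d`-wave order parameter is "`Δ_∞(0) = 0.003(6)` … We thus conclude that there is no long-range SC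
pairing in this system in the TDL"; §IV: "In the parameter regime relevant to the cuprates
(`U ∼ 6-8`) we find that the pure Hubbard model does not have a superconducting ground state" — as
the named claim `PureModelStripeCompetition := ¬ HasDWavePairFieldLROAt 8 (1/8)`. The source proves
nothing (DMRG on width-`≤ 6` cylinders, constrained-path AFQMC on cells up to `32 × 8`, two
extrapolations), and no theorem in either direction is known: a discharge
`PureModelStripeCompetition_holds` would be a rigorous proof of the absence of `d_{x²-y²}` pair-field
long-range order in the two-dimensional Hubbard ground state at `(U, δ) = (8, 1/8)`, i.e. it would
settle (negatively, at that point) the matrix of the summit `HubbardSuperconductivity` — an open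
problem ("presently unsettled", Arovas–Berg–Kivelson–Raghu 2022, §8.1). The claim therefore STAYS
a `def`.

What IS proved here (elementary, but it is what makes the entry attackable rather than vacuous):

* `exists_unit_isGroundStateInSector_hubbardTorus`: on every torus `(ℤ/Lℤ)²` (all `L`, including
  the degenerate `L = 0`, `1`) and for every `n ≤ L²`, the pure Hubbard Hamiltonian
  `hubbardTorus 2 L 1 U` has a NORMALISED ground state in the joint sector `(N, S^z) = (2n, 0)`
  (from `szSector_groundState`: `H` is Hermitian and block-diagonal in `(N↑, N↓)`).
* `hasDWavePairFieldLROAt_admissible_nonempty`: hence the hypothesis class of the summit's matrix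
  `HasDWavePairFieldLROAt U δ` — sequences of normalised `S^z = 0` sector ground states at
  `N_L = 2⌊(1-δ)L²/2⌋` — is inhabited for every `U` and every `δ ≥ -1` (so for all dopings
  `δ ∈ [0, 1]`; for `δ < -1` the prescribed sector is empty for large `L` and the matrix WOULD be
  vacuous — outside the summit's range `δ ∈ (0, 1/2)`).
* `not_hasDWavePairFieldLROAt_iff`, `pureModelStripeCompetition_iff_exists`: the barrier claim is
  equivalent to the EXISTENCE of an admissible ground-state sequence without `d`-wave pair-field
  LRO; `HasDWavePairFieldLROAt.exists_admissible_hasLongRangeOrder`: the summit's matrix at `(U, δ)`,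
  if true, produces an admissible sequence WITH LRO (it is not true for want of ground states);
  `pureModelStripeCompetition_or_summitShape`: exactly one of "the barrier claim" and "the summit's
  `∃ U > 0, ∃ δ ∈ (0, 1/2), …` via the witness `(8, 1/8)`" needs no further input from the other.
* The RANGE form `PureModelStripeCompetitionRange` (the printed scope "`U ∼ 6-8`" at `δ = 1/8`,
  §IV p. 11 and Fig. 11 of the source, transcribed over the witness class `IsCuprateRegimeWitness`)
  gets the same treatment: `pureModelStripeCompetitionRange_iff` (`∀ U ∈ [6, 8], ¬ matrix at
  (U, 1/8)`), `pureModelStripeCompetitionRange_iff_exists` (existential form per coupling, the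
  hypothesis class being inhabited at every `U` by `hasDWavePairFieldLROAt_admissible_nonempty`),
  `not_pureModelStripeCompetitionRange_iff` and `pureModelStripeCompetitionRange_or_summitShape`
  (its negation is the summit's matrix at some `U ∈ [6, 8]`, `δ = 1/8 ∈ (0, 1/2)`, hence the
  summit-shaped statement). A discharge `PureModelStripeCompetitionRange_holds` would, through
  `PureModelStripeCompetitionRange.headline`, contain `PureModelStripeCompetition_holds`; it is the
  same open problem on a whole segment of couplings and likewise STAYS a `def` (numerical claim,
  Fig. 11 rests on `16 × 4` cells at `U = 4, 6, 8`).

Mathlib/tree search: `szSector_groundState`, `exists_smul_unit` (tree, `HubbardRingPerronFrobeniusProofs`,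
`SectorSpectrum`); `Nat.floor_le_of_le`, `Fintype.card_fin` (Mathlib). Nothing on stripes or on
pair-field LRO bounds at `U > 0` exists in the tree or Mathlib (`lean search -i stripe`: no hits).

## References

* M. Qin, C.-M. Chung, H. Shi, E. Vitali, C. Hubig, U. Schollwöck, S. R. White, S. Zhang, *Absence of
  superconductivity in the pure two-dimensional Hubbard model*, Phys. Rev. X 10 (2020) 031016
  (arXiv:1910.08931), §III.B (Fig. 9), §IV.
* D. Arovas, E. Berg, S. Kivelson, S. Raghu, Annu. Rev. CMP 13 (2022) 239, §8.1.
* E. H. Lieb, PRL 62 (1989) 1201 (sectors `(N↑, N↓)`; ground states "in the `S^z = 0` subspace").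
-/

noncomputable section

namespace Literature.Barriers.HubbardSuperconductivity

open Matrix Finset Filter Literature.Probability.LatticeModels Literature.MathematicalPhysics.QuantumLattice
open scoped ComplexOrder

/-! ### Ground states exist in every admissible sector of every torus -/

/-- A nonzero scalar multiple of a sector ground state is a sector ground state (the sector is a
subspace and the eigen-equation is linear). [folklore] -/
theorem isGroundStateInSector_smul {Λ : Type*} [LinearOrder Λ] [Fintype Λ]
    {H : Matrix (Finset (Orb Λ)) (Finset (Orb Λ)) ℂ} {N : ℕ} {M : ℝ} {φ : Fock (Orb Λ)}
    (h : IsGroundStateInSector H N M φ) {c : ℂ} (hc : c ≠ 0) :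
    IsGroundStateInSector H N M (c • φ) :=
  ⟨Submodule.smul_mem _ c h.1, smul_ne_zero hc h.2.1, by rw [mulVec_smul, h.2.2, smul_comm]⟩

/-- **Normalised sector ground states of the pure Hubbard model exist on every torus.** For every
side `L` (including the degenerate tori `L = 0, 1`), every `U : ℝ` and every `n ≤ L²` there is a
unit vector `ψ` which is a ground state of `hubbardTorus 2 L 1 U` in the joint sector
`(N, S^z) = (2n, 0)`: the Hamiltonian is Hermitian and block-diagonal in the particle numbers
`(N↑, N↓)`, and the `(n, n)` block is nonzero iff `n ≤ |Λ| = L²` (`szSector_groundState`), then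
normalise (`exists_smul_unit`). Lieb, PRL 62 (1989) 1201, proof of Thm 1 ("we can work in the
`S^z = 0` subspace"). [folklore] -/
theorem exists_unit_isGroundStateInSector_hubbardTorus (U : ℝ) (L n : ℕ) (hn : n ≤ L ^ 2) :
    ∃ ψ : Fock (Orb (FermionTorus 2 L)), star ψ ⬝ᵥ ψ = 1 ∧
      IsGroundStateInSector (hubbardTorus 2 L 1 U) (2 * n) 0 ψ := by
  have hcard : n ≤ Fintype.card (FermionTorus 2 L) := by
    simpa [FermionTorus, Fintype.card_fin] using hn
  obtain ⟨⟨φ, hφ⟩, -⟩ := szSector_groundState (fermionTorusGraph 2 L) 1 U hcard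
  obtain ⟨c, hc0, hc1⟩ := exists_smul_unit hφ.2.1
  exact ⟨c • φ, hc1, isGroundStateInSector_smul hφ hc0⟩

/-- The electron number prescribed by the summit at doping `δ` fits on the torus:
`⌊(1 - δ) L² / 2⌋ ≤ L²` as soon as `δ ≥ -1` (for `δ > 1` the floor is `0`). [folklore] -/
theorem natFloor_filling_le_sq {δ : ℝ} (hδ : -1 ≤ δ) (L : ℕ) :
    ⌊(1 - δ) * (L : ℝ) ^ 2 / 2⌋₊ ≤ L ^ 2 := by
  refine Nat.floor_le_of_le ?_
  have hL : (0 : ℝ) ≤ (L : ℝ) ^ 2 := by positivity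
  have h1 : (1 - δ) * (L : ℝ) ^ 2 ≤ 2 * (L : ℝ) ^ 2 :=
    mul_le_mul_of_nonneg_right (by linarith) hL
  push_cast
  linarith

/-- **The hypothesis class of the summit's matrix is inhabited.** For every coupling `U` and every
`δ ≥ -1` (in particular every doping `δ ∈ [0, 1]`, so throughout the summit's range `(0, 1/2)` and
at the barrier's point `δ = 1/8`) there IS a sequence `(N_L, ψ_L)_L` admissible for
`HasDWavePairFieldLROAt U δ`: `N_L = 2⌊(1-δ)L²/2⌋`, `ψ_L` a normalised ground state of the pure
Hubbard model `hubbardTorus 2 L 1 U` in the sector `(N_L, S^z = 0)` — for EVERY `L`, not only the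
even sides the matrix asks about. Consequently `HasDWavePairFieldLROAt U δ` is never vacuously
true in this range, and `PureModelStripeCompetition` is a statement about actual ground states.
[folklore] -/
theorem hasDWavePairFieldLROAt_admissible_nonempty (U : ℝ) {δ : ℝ} (hδ : -1 ≤ δ) :
    ∃ (N : ℕ → ℕ) (ψ : ∀ L, Fock (Orb (FermionTorus 2 L))),
      ∀ L, N L = 2 * ⌊(1 - δ) * (L : ℝ) ^ 2 / 2⌋₊ ∧ star (ψ L) ⬝ᵥ ψ L = 1 ∧
        IsGroundStateInSector (hubbardTorus 2 L 1 U) (N L) 0 (ψ L) := by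
  have key : ∀ L : ℕ, ∃ ψ : Fock (Orb (FermionTorus 2 L)), star ψ ⬝ᵥ ψ = 1 ∧
      IsGroundStateInSector (hubbardTorus 2 L 1 U) (2 * ⌊(1 - δ) * (L : ℝ) ^ 2 / 2⌋₊) 0 ψ :=
    fun L => exists_unit_isGroundStateInSector_hubbardTorus U L _ (natFloor_filling_le_sq hδ L)
  choose ψ hψ using key
  exact ⟨fun L => 2 * ⌊(1 - δ) * (L : ℝ) ^ 2 / 2⌋₊, ψ, fun L => ⟨rfl, hψ L⟩⟩

/-! ### The barrier claim in existential form -/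

/-- **Negation of the summit's matrix at `(U, δ)`, pushed through the quantifiers**: the matrix
fails iff SOME admissible sequence of normalised `S^z = 0` sector ground states lacks `d_{x²-y²}`
pair-field long-range order along the even sides. (Pure logic; recorded because it is the form in
which the numerical literature — Qin et al. 2020, §III — speaks: "the ground state has filled
stripes … no long-range SC pairing".) [folklore] -/
theorem not_hasDWavePairFieldLROAt_iff (U δ : ℝ) :
    ¬ HasDWavePairFieldLROAt U δ ↔
      ∃ (N : ℕ → ℕ) (ψ : ∀ L, Fock (Orb (FermionTorus 2 L))),
        (∀ L, Even L → N L = 2 * ⌊(1 - δ) * (L : ℝ) ^ 2 / 2⌋₊ ∧ star (ψ L) ⬝ᵥ ψ L = 1 ∧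
            IsGroundStateInSector (hubbardTorus 2 L 1 U) (N L) 0 (ψ L)) ∧
          ¬ HasLongRangeOrder (fun k => halfOpenBox 2 (2 * k))
              (fun k => torusPullback (pairFieldCorr dWaveFormFactor ψ) (2 * k)) := by
  unfold HasDWavePairFieldLROAt
  push Not
  rfl

/-- **`PureModelStripeCompetition` in existential form.** The barrier claim (Qin et al. 2020:
no `d`-wave pairing order at `U = 8`, `h = 1/8`, `t' = 0`) says exactly: there is a sequence of
normalised `S^z = 0` sector ground states of the pure Hubbard model on the even tori, at
`N_L = 2⌊(7/8)L²/2⌋` electrons, WITHOUT `d_{x²-y²}` pair-field long-range order. By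
`hasDWavePairFieldLROAt_admissible_nonempty` admissible sequences exist, so the content of the
claim is the second conjunct — a property of actual Hubbard ground states, open in both
directions. [cite: QinEtAl2020, §III.B Fig. 9 and §IV] -/
theorem pureModelStripeCompetition_iff_exists :
    PureModelStripeCompetition ↔
      ∃ (N : ℕ → ℕ) (ψ : ∀ L, Fock (Orb (FermionTorus 2 L))),
        (∀ L, Even L → N L = 2 * ⌊(1 - 1 / 8) * (L : ℝ) ^ 2 / 2⌋₊ ∧ star (ψ L) ⬝ᵥ ψ L = 1 ∧
            IsGroundStateInSector (hubbardTorus 2 L 1 8) (N L) 0 (ψ L)) ∧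
          ¬ HasLongRangeOrder (fun k => halfOpenBox 2 (2 * k))
              (fun k => torusPullback (pairFieldCorr dWaveFormFactor ψ) (2 * k)) :=
  not_hasDWavePairFieldLROAt_iff 8 (1 / 8)

/-- **The summit's matrix is contentful where it is claimed.** If `HasDWavePairFieldLROAt U δ`
holds at some `δ ≥ -1`, then there is an admissible ground-state sequence (defined at every `L`)
which HAS `d_{x²-y²}` pair-field long-range order along the even sides — the matrix cannot hold
for want of ground states. [folklore] -/
theorem HasDWavePairFieldLROAt.exists_admissible_hasLongRangeOrder {U δ : ℝ}
    (h : HasDWavePairFieldLROAt U δ) (hδ : -1 ≤ δ) :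
    ∃ (N : ℕ → ℕ) (ψ : ∀ L, Fock (Orb (FermionTorus 2 L))),
      (∀ L, N L = 2 * ⌊(1 - δ) * (L : ℝ) ^ 2 / 2⌋₊ ∧ star (ψ L) ⬝ᵥ ψ L = 1 ∧
          IsGroundStateInSector (hubbardTorus 2 L 1 U) (N L) 0 (ψ L)) ∧
        HasLongRangeOrder (fun k => halfOpenBox 2 (2 * k))
          (fun k => torusPullback (pairFieldCorr dWaveFormFactor ψ) (2 * k)) := by
  obtain ⟨N, ψ, hNψ⟩ := hasDWavePairFieldLROAt_admissible_nonempty U hδ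
  exact ⟨N, ψ, hNψ, h N ψ fun L _ => hNψ L⟩

/-- `(8, 1/8)` lies in the summit's parameter range `U > 0`, `δ ∈ (0, 1/2)`. [folklore] -/
theorem eight_eighth_mem_summitRange : (0 : ℝ) < 8 ∧ (1 / 8 : ℝ) ∈ Set.Ioo 0 (1 / 2) :=
  ⟨by norm_num, by norm_num, by norm_num⟩

/-- **Dichotomy for route planners.** Either the barrier claim holds (Qin et al.'s finding is
correct as transcribed), or the summit's matrix holds at the cuprate-regime witness `(8, 1/8)` and
hence the summit-shaped statement `∃ U > 0, ∃ δ ∈ (0, 1/2), HasDWavePairFieldLROAt U δ` (which is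
`HubbardSuperconductivity` with both files in scope) holds outright. Excluded middle; recorded so
that the logical position of the numerical claim is explicit. [folklore] -/
theorem pureModelStripeCompetition_or_summitShape :
    PureModelStripeCompetition ∨
      ∃ U > (0 : ℝ), ∃ δ ∈ Set.Ioo (0 : ℝ) (1 / 2), HasDWavePairFieldLROAt U δ := by
  by_cases h : PureModelStripeCompetition
  · exact Or.inl h
  · exact Or.inr ⟨8, eight_eighth_mem_summitRange.1, 1 / 8, eight_eighth_mem_summitRange.2,
      not_not.mp h⟩

/-! ### The range form `PureModelStripeCompetitionRange` ("`U ∼ 6-8`", `δ = 1/8`) -/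

/-- **The range claim, unfolded over its witness class.** `PureModelStripeCompetitionRange` says
exactly: for every coupling `U ∈ [6, 8]` the summit's matrix fails at hole doping `δ = 1/8`
("In the parameter regime relevant to the cuprates (`U ∼ 6-8`) we find that the pure Hubbard
model does not have a superconducting ground state"). [cite: QinEtAl2020, §IV p. 11 and Fig. 11] -/
theorem pureModelStripeCompetitionRange_iff :
    PureModelStripeCompetitionRange ↔
      ∀ U ∈ Set.Icc (6 : ℝ) 8, ¬ HasDWavePairFieldLROAt U (1 / 8) := by
  refine ⟨fun h U hU => h U (1 / 8) ⟨hU, rfl⟩, fun h U δ hUδ => ?_⟩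
  obtain ⟨hU, rfl⟩ := hUδ
  exact h U hU

/-- **`PureModelStripeCompetitionRange` in existential form.** For every `U ∈ [6, 8]` there is a
sequence of normalised `S^z = 0` sector ground states of the pure Hubbard model `hubbardTorus 2 L 1 U`
on the even tori, at `N_L = 2⌊(7/8)L²/2⌋` electrons, WITHOUT `d_{x²-y²}` pair-field long-range
order. The hypothesis class is inhabited at every `U` (`hasDWavePairFieldLROAt_admissible_nonempty`),
so at each coupling the content is the second conjunct — a property of actual Hubbard ground
states, open in both directions; the source supports it by `16 × 4` computations at `U = 4, 6, 8`
(Fig. 11) and the thermodynamic-limit extrapolation at `U = 8` only (Fig. 9).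
[cite: QinEtAl2020, §III.D Fig. 11 and §IV p. 11] -/
theorem pureModelStripeCompetitionRange_iff_exists :
    PureModelStripeCompetitionRange ↔
      ∀ U ∈ Set.Icc (6 : ℝ) 8, ∃ (N : ℕ → ℕ) (ψ : ∀ L, Fock (Orb (FermionTorus 2 L))),
        (∀ L, Even L → N L = 2 * ⌊(1 - 1 / 8) * (L : ℝ) ^ 2 / 2⌋₊ ∧ star (ψ L) ⬝ᵥ ψ L = 1 ∧
            IsGroundStateInSector (hubbardTorus 2 L 1 U) (N L) 0 (ψ L)) ∧
          ¬ HasLongRangeOrder (fun k => halfOpenBox 2 (2 * k))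
              (fun k => torusPullback (pairFieldCorr dWaveFormFactor ψ) (2 * k)) := by
  rw [pureModelStripeCompetitionRange_iff]
  exact forall₂_congr fun U _ => not_hasDWavePairFieldLROAt_iff U (1 / 8)

/-- Every cuprate-regime witness `(U, 1/8)`, `U ∈ [6, 8]`, lies in the summit's parameter range
`U > 0`, `δ ∈ (0, 1/2)`. [folklore] -/
theorem IsCuprateRegimeWitness.mem_summitRange {U δ : ℝ} (h : IsCuprateRegimeWitness U δ) :
    0 < U ∧ δ ∈ Set.Ioo (0 : ℝ) (1 / 2) := by
  obtain ⟨⟨h6, -⟩, rfl⟩ := h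
  exact ⟨by linarith, by norm_num, by norm_num⟩

/-- **Negation of the range claim**: `PureModelStripeCompetitionRange` fails iff the summit's
matrix `HasDWavePairFieldLROAt U (1/8)` HOLDS at some coupling `U ∈ [6, 8]` — i.e. iff Qin et
al.'s conclusion for "`U ∼ 6-8`" is wrong at some point of the segment. (Pure logic.) [folklore] -/
theorem not_pureModelStripeCompetitionRange_iff :
    ¬ PureModelStripeCompetitionRange ↔
      ∃ U ∈ Set.Icc (6 : ℝ) 8, HasDWavePairFieldLROAt U (1 / 8) := by
  rw [pureModelStripeCompetitionRange_iff]
  push Not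
  rfl

/-- **Dichotomy for route planners (range form).** Either the range claim holds (no `d`-wave
pair-field LRO anywhere on `U ∈ [6, 8]`, `δ = 1/8`, as Qin et al. conclude), or the summit's
matrix holds at some cuprate-regime witness and hence the summit-shaped statement
`∃ U > 0, ∃ δ ∈ (0, 1/2), HasDWavePairFieldLROAt U δ` holds outright. In particular a Lean
discharge of `PureModelStripeCompetitionRange` would refute the summit's matrix on the whole
segment, and a Lean refutation of it would prove the summit: neither is a formalization exercise.
[folklore] -/
theorem pureModelStripeCompetitionRange_or_summitShape :
    PureModelStripeCompetitionRange ∨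
      ∃ U > (0 : ℝ), ∃ δ ∈ Set.Ioo (0 : ℝ) (1 / 2), HasDWavePairFieldLROAt U δ := by
  by_cases h : PureModelStripeCompetitionRange
  · exact Or.inl h
  · obtain ⟨U, hU, hLRO⟩ := not_pureModelStripeCompetitionRange_iff.mp h
    have hW : IsCuprateRegimeWitness U (1 / 8) := ⟨hU, rfl⟩
    exact Or.inr ⟨U, hW.mem_summitRange.1, 1 / 8, hW.mem_summitRange.2, hLRO⟩

/-- The range claim delivers the headline's existential form at `U = 8` (composition of
`PureModelStripeCompetitionRange.headline` with `pureModelStripeCompetition_iff_exists`).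
[cite: QinEtAl2020, §III.B Fig. 9 and §IV p. 11] -/
theorem PureModelStripeCompetitionRange.exists_headline (h : PureModelStripeCompetitionRange) :
    ∃ (N : ℕ → ℕ) (ψ : ∀ L, Fock (Orb (FermionTorus 2 L))),
      (∀ L, Even L → N L = 2 * ⌊(1 - 1 / 8) * (L : ℝ) ^ 2 / 2⌋₊ ∧ star (ψ L) ⬝ᵥ ψ L = 1 ∧
          IsGroundStateInSector (hubbardTorus 2 L 1 8) (N L) 0 (ψ L)) ∧
        ¬ HasLongRangeOrder (fun k => halfOpenBox 2 (2 * k))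
            (fun k => torusPullback (pairFieldCorr dWaveFormFactor ψ) (2 * k)) :=
  pureModelStripeCompetition_iff_exists.mp h.headline

end Literature.Barriers.HubbardSuperconductivity

end
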